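import Literature.AlgebraicGeometry.AbelianSchemes.TupleRelBaseChangeUnique          -- ★ `exists_tupleRel_id_of_tupleRel_of_tupleRel` (uniqueness), canonical clauses
import Literature.AlgebraicGeometry.AbelianSchemes.RingActionTransportAlongIso        -- ★ (GS-1a) `RingAction.exists_transport_of_iso_comp`
import Literature.AlgebraicGeometry.ModuliOfAbelianVarieties.SiegelAdmissibleOfIsoId -- ★ `AbelianSchemeOver.exists_iso_of_isBaseChangeVia_id`
import Literature.AlgebraicGeometry.Limits.LocalizationRelativeGroupSpread           -- ★ stage vocabulary `genOver` (§3)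
import HarnessLib

/-!
# An `𝒪`-action on a pull-back DESCENDS TO THE BASE CHANGE: a tuple-with-action that is a pull-back of an action-free tuple `𝒯` along `f`
# is isomorphic, AS A TUPLE WITH ACTION, to the base change `𝒯 ×_S T` equipped with a transported action

Topic `AlgebraicGeometry/AbelianSchemes`; namespace `Literature.AlgebraicGeometry.AbelianSchemes.AbelianSchemeOver`.  THEOREMS ONLY (no definition,
no named fact, no instance, no notation, no `sorry`).  Cell hodgecm-mathlib (D-0151), P6 «MOD programme» (crux hLiu418 = stmt-HodgeConjecture-24832,
`--supports`, count-neutral); organ for road Σ of the P-line socket `stub_SPREAD` (LEAD F0P6-plan (g3) 2026-09-02T01:09:11Z «ROAD (Σ) OF RECORD»;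
B-p18 (g38) census `CENSUS-GS1-OneCommonStage.v1` §0: «the ring action `ι` (not Siegel data) then spreads by (s1-ι) on the pulled-back family»).
Under road Σ the stage abelian scheme `𝒜ₜ → P ⊗ D(t)` is the pull-back of a universal polarised family and carries NO `𝒪`-action, while the
E-witness `(A_E, ι_E, Â_E, 𝒫_E, λ_E, φ_E)` over the generic fibre is related to `𝒜ₜ` (classifying map + ★ cancellation) along the generic base
map; ★ (s1-ι) `exists_stage_ringAction` wants a `RingAction` ON `𝒜ₜ ×_{P⊗D(t)} (P ⊗ Spec K)` (★ `genOver`).  This file produces it, together with the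
six-clause isomorphism of tuples recording that nothing was lost.  HC_CM is proved only modulo the printed citations until rung 0 closes; nothing
here is about HC.

THE MATHEMATICS ([MumfordFogartyKirwan1994] Ch. 7 §2 Def. 7.2–7.3: pull-backs of triples are unique up to a unique isomorphism of triples;
[GortzWedhorn2020] Prop. 4.16; [Kottwitz1992] §5 p. 390: the `𝒪_B`-action `ι` is part of the moduli datum and is transported along isomorphisms).
Let `𝒯 = (𝒜, (Â, 𝒫), λ, φ)` be a tuple over `S` WITHOUT action, `f : T → S`, and `𝒯₁ = (A₁, ι₁, (Â₁, 𝒫₁), λ₁, φ₁)` a tuple over `T` WITH an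
`𝒪`-action `ι₁` which is a pull-back of `𝒯` along `f` via `(G, Ĝ)` (the four action-free clauses).  The base change `𝒯 ×_S T` is another pull-back
along `f` (★ canonical clauses), so uniqueness (★ `exists_tupleRel_id_of_tupleRel_of_tupleRel`, with the EMPTY action index) gives comparison
isomorphisms `H : A₁ ≅ 𝒜 ×_S T`, `Ĥ` over `T` satisfying the four clauses along `𝟙 T` with `H ≫ pr₁ = G`; `H` is an isomorphism of group schemes
(★ `exists_iso_of_isBaseChangeVia_id`), so `ι₁` transports along it to a ring action `ι` on `𝒜 ×_S T` (★ GS-1a `RingAction.exists_transport_of_iso_comp`)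
with `ι₁(a) ≫ H = H ≫ ι(a)` — the fifth clause.  §1 also records the base-map bookkeeping every consumer needs: a six-clause relation along `f` may
be re-read along any `f′ = f` (`tupleRel_congr_base`), and every tuple is related to itself along `𝟙` (`tupleRel_refl`).

MAIN STATEMENTS.  §1 `tupleRel_congr_base`, `tupleRel_refl`; §2 **`exists_ringAction_baseChange_tupleRel_id_of_tupleRel`** (the head:
`∃ ρ H Ĥ, IsIso H ∧ IsIso Ĥ ∧ H ≫ pr₁ = G ∧ Ĥ ≫ pr₁ = Ĝ ∧` six clauses of `𝒯₁` into `(𝒯 ×_S T, ρ)` along `𝟙 T`); §3 the road-Σ instance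
**`exists_ringAction_genOver_tupleRel_id_of_tupleRel`** (`f :=` the cone map `P ◁ leg : P ⊗ Spec K → P ⊗ D(t)`, output typed ON
`𝒜ₜ.baseChange (genOver S K P t).hom` = the input of ★ (s1-ι) `exists_stage_ringAction`); §4 (EDITION 2, B-p18 (g39)) ALONG AN ISOMORPHISM OF
BASES **`exists_ringAction_baseChange_tupleRel_of_tupleRel_iso_comp`**: `e : X′ ≅ Y`, `g : Y → S`, a four-clause relation of `(A₁, …)` (over `X′`,
with action `ρ₁`) into `𝒜`՚s tuple along `e ≫ g` ⇒ a ring action `ρ` on `𝒜 ×_S Y` AND a six-clause relation of `(A₁, ρ₁, …)` into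
`(𝒜 ×_S Y, ρ, …)` ALONG `e` — road Σ՚s one call with `e := 𝓜.genericIso⁻¹`, `g := P ◁ leg`.

## References
* [MumfordFogartyKirwan1994] D. Mumford, J. Fogarty, F. Kirwan, *Geometric Invariant Theory*, 3rd ed. (1994), Ch. 7 §2 Def. 7.2 (p. 129), Def. 7.3 (p. 130).
* [GortzWedhorn2020] U. Görtz, T. Wedhorn, *Algebraic Geometry I*, 2nd ed. (2020), Prop. 4.16 (p. 101), Section (4.7) (pp. 107–108).
* [Kottwitz1992] R. Kottwitz, *Points on some Shimura varieties over finite fields*, JAMS 5 (1992), §5 (p. 390).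
-/

set_option autoImplicit false

noncomputable section

-- Mathlib's `Over`/pull-back API is stated across semireducible wrappers (as in the ★ `AbelianSchemes/*` files).
set_option backward.isDefEq.respectTransparency false

universe u

open CategoryTheory CategoryTheory.Limits AlgebraicGeometry MonoidalCategory

namespace Literature.AlgebraicGeometry.AbelianSchemes

namespace AbelianSchemeOver

/-! ### §1 Bookkeeping: re-reading a relation along an equal base map; reflexivity -/

section Bookkeeping

variable {S T : Scheme.{u}} {A : AbelianSchemeOver S} {A₁ : AbelianSchemeOver T} {D : A.DualPair} {D₁ : A₁.DualPair}
  {lam : A.X ⟶ D.hat.X} {lam₁ : A₁.X ⟶ D₁.hat.X} {g n : ℕ} {φ : A.LevelStructure g n} {φ₁ : A₁.LevelStructure g n}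
  {O : Type*} {act : O → (A.X ⟶ A.X)} {act₁ : O → (A₁.X ⟶ A₁.X)} {f f' : T ⟶ S}
  {G : A₁.X.left ⟶ A.X.left} {Ĝ : D₁.hat.X.left ⟶ D.hat.X.left}

/-- **A six-clause relation along `f` may be re-read along any `f′ = f`** (the base map enters the clauses only through propositions and the
proof arguments of `pullback.map`). [cite: MumfordFogartyKirwan1994, Ch. 7 §2 Definition 7.2 (p. 129)] -/
theorem tupleRel_congr_base (hf : f = f')
    (h : φ₁.IsBaseChangeVia φ f G ∧ D₁.hat.IsBaseChangeVia D.hat f Ĝ ∧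
      (∃ (wG : A₁.X.hom ≫ f = G ≫ A.X.hom) (wĜ : D₁.hat.X.hom ≫ f = Ĝ ≫ D.hat.X.hom),
        Nonempty ((Scheme.Modules.pullback
          (pullback.map A₁.X.hom D₁.hat.X.hom A.X.hom D.hat.X.hom G Ĝ f wG wĜ)).obj D.P ≅ D₁.P)) ∧
      lam₁.left ≫ Ĝ = G ≫ lam.left ∧ ∀ a : O, (act₁ a).left ≫ G = G ≫ (act a).left) :
    φ₁.IsBaseChangeVia φ f' G ∧ D₁.hat.IsBaseChangeVia D.hat f' Ĝ ∧
      (∃ (wG : A₁.X.hom ≫ f' = G ≫ A.X.hom) (wĜ : D₁.hat.X.hom ≫ f' = Ĝ ≫ D.hat.X.hom),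
        Nonempty ((Scheme.Modules.pullback
          (pullback.map A₁.X.hom D₁.hat.X.hom A.X.hom D.hat.X.hom G Ĝ f' wG wĜ)).obj D.P ≅ D₁.P)) ∧
      lam₁.left ≫ Ĝ = G ≫ lam.left ∧ ∀ a : O, (act₁ a).left ≫ G = G ≫ (act a).left := by
  subst hf
  exact h

/-- **Every tuple is related to itself along `𝟙 S` via `(𝟙, 𝟙)`** (the six clauses: ★ `LevelStructure.IsBaseChangeVia.refl`, ★ `IsBaseChangeVia.refl`,
Poincaré by Mathlib `Scheme.Modules.pullbackId`, `λ` and the action by `simp`). [cite: MumfordFogartyKirwan1994, Ch. 7 §2 Definition 7.2 (p. 129)] -/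
theorem tupleRel_refl (A : AbelianSchemeOver S) (D : A.DualPair) (lam : A.X ⟶ D.hat.X) (φ : A.LevelStructure g n)
    (act : O → (A.X ⟶ A.X)) :
    φ.IsBaseChangeVia φ (𝟙 S) (𝟙 A.X.left) ∧ D.hat.IsBaseChangeVia D.hat (𝟙 S) (𝟙 D.hat.X.left) ∧
      (∃ (wG : A.X.hom ≫ 𝟙 S = 𝟙 A.X.left ≫ A.X.hom) (wĜ : D.hat.X.hom ≫ 𝟙 S = 𝟙 D.hat.X.left ≫ D.hat.X.hom),
        Nonempty ((Scheme.Modules.pullback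
          (pullback.map A.X.hom D.hat.X.hom A.X.hom D.hat.X.hom (𝟙 A.X.left) (𝟙 D.hat.X.left) (𝟙 S) wG wĜ)).obj D.P ≅ D.P)) ∧
      lam.left ≫ 𝟙 D.hat.X.left = 𝟙 A.X.left ≫ lam.left ∧ ∀ a : O, (act a).left ≫ 𝟙 A.X.left = 𝟙 A.X.left ≫ (act a).left := by
  refine ⟨LevelStructure.IsBaseChangeVia.refl φ, IsBaseChangeVia.refl D.hat, ⟨by simp, by simp, ?_⟩, by simp, fun a => by simp⟩
  have hmap : pullback.map A.X.hom D.hat.X.hom A.X.hom D.hat.X.hom (𝟙 _) (𝟙 _) (𝟙 S) (by simp) (by simp) = 𝟙 _ := by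
    apply pullback.hom_ext <;> simp
  rw [hmap]
  exact ⟨(Scheme.Modules.pullbackId _).app D.P⟩

end Bookkeeping

/-! ### §2 THE HEAD: the action on a pull-back descends to the base change, as a six-clause isomorphism of tuples -/

section Descent

variable {S T : Scheme.{u}} (𝒜 : AbelianSchemeOver S) (D : 𝒜.DualPair) (pol : 𝒜.Polarization D) {g n : ℕ} (lvl : 𝒜.LevelStructure g n)
  (f : T ⟶ S) {A₁ : AbelianSchemeOver T} {D₁ : A₁.DualPair} {lam₁ : A₁.X ⟶ D₁.hat.X} {φ₁ : A₁.LevelStructure g n}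
  {O : Type*} [CommRing O] (ρ₁ : RingAction O A₁) {G : A₁.X.left ⟶ 𝒜.X.left} {Ĝ : D₁.hat.X.left ⟶ D.hat.X.left}

/-- **AN `𝒪`-ACTION ON A PULL-BACK DESCENDS TO THE BASE CHANGE, AS AN ISOMORPHISM OF TUPLES WITH ACTION** ([MumfordFogartyKirwan1994] Def. 7.2–7.3;
[Kottwitz1992] §5).  Let `(A₁, ι₁, (Â₁, 𝒫₁), λ₁, φ₁)` over `T` carry a ring action `ι₁ = ρ₁` and be a pull-back of the action-free tuple
`(𝒜, (Â, 𝒫), λ, φ)` over `S` along `f` via `(G, Ĝ)` (the four clauses: level ∕ `X`, `X̂`, Poincaré, `λ`).  Then there are a ring action `ρ` on the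
base change `𝒜 ×_S T` (★ `AbelianSchemeOver.baseChange`) and ISOMORPHISMS `H : A₁ → 𝒜 ×_S T`, `Ĥ : Â₁ → Â ×_S T` over `T` with `H ≫ pr₁ = G`,
`Ĥ ≫ pr₁ = Ĝ`, satisfying ALL SIX clauses along `𝟙 T` from `(A₁, ρ₁, …)` to `(𝒜 ×_S T, ρ, Â ×_S T, 𝒫_T, λ_T, φ_T)` — uniqueness of pull-backs
(★ `exists_tupleRel_id_of_tupleRel_of_tupleRel` against the canonical clauses ★ `LevelStructure.baseChange_isBaseChangeVia` ∕ ★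
`DualPair.baseChange_hat_isBaseChangeVia` ∕ ★ `DualPair.nonempty_pullback_map_P_iso_baseChange_P` ∕ ★ `Polarization.baseChange_lam_left_comp_fst`,
with the empty action index), then transport of `ρ₁` along the group-scheme isomorphism `H` (★ `exists_iso_of_isBaseChangeVia_id`, ★ GS-1a
`RingAction.exists_transport_of_iso_comp`: `ρ(a) = H⁻¹ ≫ ρ₁(a) ≫ H`). [cite: MumfordFogartyKirwan1994, Ch. 7 §2 Definition 7.2 (p. 129) and Definition 7.3 (p. 130)]
[cite: GortzWedhorn2020, Prop. 4.16 (p. 101)] [cite: Kottwitz1992, §5 (p. 390)] -/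
theorem exists_ringAction_baseChange_tupleRel_id_of_tupleRel
    (h : φ₁.IsBaseChangeVia lvl f G ∧ D₁.hat.IsBaseChangeVia D.hat f Ĝ ∧
      (∃ (wG : A₁.X.hom ≫ f = G ≫ 𝒜.X.hom) (wĜ : D₁.hat.X.hom ≫ f = Ĝ ≫ D.hat.X.hom),
        Nonempty ((Scheme.Modules.pullback
          (pullback.map A₁.X.hom D₁.hat.X.hom 𝒜.X.hom D.hat.X.hom G Ĝ f wG wĜ)).obj D.P ≅ D₁.P)) ∧
      lam₁.left ≫ Ĝ = G ≫ pol.lam.left) :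
    ∃ (ρ : RingAction O (𝒜.baseChange f)) (H : A₁.X.left ⟶ (𝒜.baseChange f).X.left) (Ĥ : D₁.hat.X.left ⟶ (D.baseChange f).hat.X.left),
      IsIso H ∧ IsIso Ĥ ∧ H ≫ pullback.fst 𝒜.X.hom f = G ∧ Ĥ ≫ pullback.fst D.hat.X.hom f = Ĝ ∧
      (φ₁.IsBaseChangeVia (lvl.baseChange f) (𝟙 T) H ∧ D₁.hat.IsBaseChangeVia (D.baseChange f).hat (𝟙 T) Ĥ ∧
        (∃ (wG : A₁.X.hom ≫ 𝟙 T = H ≫ (𝒜.baseChange f).X.hom) (wĜ : D₁.hat.X.hom ≫ 𝟙 T = Ĥ ≫ (D.baseChange f).hat.X.hom),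
          Nonempty ((Scheme.Modules.pullback
            (pullback.map A₁.X.hom D₁.hat.X.hom (𝒜.baseChange f).X.hom (D.baseChange f).hat.X.hom H Ĥ (𝟙 T) wG wĜ)).obj
              (D.baseChange f).P ≅ D₁.P)) ∧
        lam₁.left ≫ Ĥ = H ≫ (pol.baseChange f).lam.left ∧ ∀ a : O, (ρ₁.i a).left ≫ H = H ≫ (ρ.i a).left) := by
  -- (1) the canonical four clauses of `𝒯 ×_S T → 𝒯` along `f`, with the EMPTY action index
  have wA : (𝒜.baseChange f).X.hom ≫ f = pullback.fst 𝒜.X.hom f ≫ 𝒜.X.hom := pullback.condition.symm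
  have wH : (D.baseChange f).hat.X.hom ≫ f = pullback.fst D.hat.X.hom f ≫ D.hat.X.hom := pullback.condition.symm
  have h₂ : (lvl.baseChange f).IsBaseChangeVia lvl f (pullback.fst 𝒜.X.hom f) ∧
      (D.baseChange f).hat.IsBaseChangeVia D.hat f (pullback.fst D.hat.X.hom f) ∧
      (∃ (wG : (𝒜.baseChange f).X.hom ≫ f = pullback.fst 𝒜.X.hom f ≫ 𝒜.X.hom)
          (wĜ : (D.baseChange f).hat.X.hom ≫ f = pullback.fst D.hat.X.hom f ≫ D.hat.X.hom),
        Nonempty ((Scheme.Modules.pullback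
          (pullback.map (𝒜.baseChange f).X.hom (D.baseChange f).hat.X.hom 𝒜.X.hom D.hat.X.hom
            (pullback.fst 𝒜.X.hom f) (pullback.fst D.hat.X.hom f) f wG wĜ)).obj D.P ≅ (D.baseChange f).P)) ∧
      (pol.baseChange f).lam.left ≫ pullback.fst D.hat.X.hom f = pullback.fst 𝒜.X.hom f ≫ pol.lam.left ∧
      ∀ a : PEmpty.{1}, ((PEmpty.elim a : (𝒜.baseChange f).X ⟶ (𝒜.baseChange f).X)).left ≫ pullback.fst 𝒜.X.hom f =
        pullback.fst 𝒜.X.hom f ≫ ((PEmpty.elim a : 𝒜.X ⟶ 𝒜.X)).left :=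
    ⟨lvl.baseChange_isBaseChangeVia f, D.baseChange_hat_isBaseChangeVia f,
      ⟨wA, wH, D.nonempty_pullback_map_P_iso_baseChange_P f wA wH⟩, pol.baseChange_lam_left_comp_fst f, fun a => a.elim⟩
  have h₁ : φ₁.IsBaseChangeVia lvl f G ∧ D₁.hat.IsBaseChangeVia D.hat f Ĝ ∧
      (∃ (wG : A₁.X.hom ≫ f = G ≫ 𝒜.X.hom) (wĜ : D₁.hat.X.hom ≫ f = Ĝ ≫ D.hat.X.hom),
        Nonempty ((Scheme.Modules.pullback
          (pullback.map A₁.X.hom D₁.hat.X.hom 𝒜.X.hom D.hat.X.hom G Ĝ f wG wĜ)).obj D.P ≅ D₁.P)) ∧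
      lam₁.left ≫ Ĝ = G ≫ pol.lam.left ∧
      ∀ a : PEmpty.{1}, ((PEmpty.elim a : A₁.X ⟶ A₁.X)).left ≫ G = G ≫ ((PEmpty.elim a : 𝒜.X ⟶ 𝒜.X)).left :=
    ⟨h.1, h.2.1, h.2.2.1, h.2.2.2, fun a => a.elim⟩
  -- (2) uniqueness: `A₁ ≅ 𝒜 ×_S T` as tuples along `𝟙 T` (four clauses; the action index is empty)
  obtain ⟨H, Ĥ, hH, hĤ, hHG, hĤG, hl, hh, hP, hlam, -⟩ := exists_tupleRel_id_of_tupleRel_of_tupleRel h₂ h₁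
  -- (3) `H` is an isomorphism of group schemes over `T`; transport `ρ₁` along it
  obtain ⟨e, he, heMon⟩ := exists_iso_of_isBaseChangeVia_id hl.1
  haveI := heMon
  obtain ⟨ρ, -, -, hρ, -⟩ := RingAction.exists_transport_of_iso_comp ρ₁ e
  refine ⟨ρ, H, Ĥ, hH, hĤ, hHG, hĤG, hl, hh, hP, hlam, fun a => ?_⟩
  rw [← he, ← Over.comp_left, ← Over.comp_left, hρ a]

end Descent

/-! ### §3 The road-Σ instance: an action over the generic fibre descends to `𝒜ₜ ×_{P⊗D(t)} (P ⊗ Spec K)` — the input of ★ (s1-ι) -/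

section Stage

open Literature.AlgebraicGeometry.Motives (SchemeOver specOver)
open Literature.AlgebraicGeometry.Limits.LocApprox (Idx baseDiagram leg genOver)

variable {A : Type u} [CommRing A] (S : Submonoid A) (K : Type u) [CommRing K] [Algebra A K] [IsLocalization S K]
  (P : SchemeOver A) (t : Idx S)
  (𝒜 : AbelianSchemeOver (P ⊗ (baseDiagram S).obj t).left) (D : 𝒜.DualPair) (pol : 𝒜.Polarization D) {g n : ℕ} (lvl : 𝒜.LevelStructure g n)
  {A₁ : AbelianSchemeOver (genOver S K P t).left} {D₁ : A₁.DualPair} {lam₁ : A₁.X ⟶ D₁.hat.X} {φ₁ : A₁.LevelStructure g n}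
  {O : Type*} [CommRing O] (ρ₁ : RingAction O A₁) {G : A₁.X.left ⟶ 𝒜.X.left} {Ĝ : D₁.hat.X.left ⟶ D.hat.X.left}

/-- **ROAD Σ, the input of ★ (s1-ι).**  Let `𝒜 → P ⊗ D(t)` be a stage abelian scheme with dual pair, polarisation and level structure but NO
action (e.g. the pull-back of a universal polarised family along a spread classifying map), and `(A₁, ρ₁, (Â₁, 𝒫₁), λ₁, φ₁)` a tuple WITH
`𝒪`-action over the generic base `P ⊗ Spec K` (★ `genOver`; e.g. the E-witness moved along the model's generic isomorphism) which is a pull-back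
of `𝒜`'s tuple along the cone map `P ◁ leg : P ⊗ Spec K → P ⊗ D(t)` (four clauses via `(G, Ĝ)`).  Then the generic base change
`𝒜 ×_{P⊗D(t)} (P ⊗ Spec K) = 𝒜.baseChange (genOver S K P t).hom` carries a ring action `ρ` — EXACTLY the `ρ : RingAction O (𝒜ₜ.baseChange (genOver …).hom)`
that ★ `exists_stage_ringAction` spreads to a finer stage — together with isomorphisms `(H, Ĥ)` over `P ⊗ Spec K` satisfying the six clauses along
`𝟙` from `(A₁, ρ₁, …)` to `(𝒜.baseChange _, ρ, …)`, `H ≫ pr₁ = G`, `Ĥ ≫ pr₁ = Ĝ`. [cite: Kottwitz1992, §5 (p. 390)]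
[cite: MumfordFogartyKirwan1994, Ch. 7 §2 Definition 7.2 (p. 129) and Definition 7.3 (p. 130)] [cite: GortzWedhorn2020, Prop. 4.16 (p. 101)] -/
theorem exists_ringAction_genOver_tupleRel_id_of_tupleRel
    (h : φ₁.IsBaseChangeVia lvl (genOver S K P t).hom G ∧ D₁.hat.IsBaseChangeVia D.hat (genOver S K P t).hom Ĝ ∧
      (∃ (wG : A₁.X.hom ≫ (genOver S K P t).hom = G ≫ 𝒜.X.hom) (wĜ : D₁.hat.X.hom ≫ (genOver S K P t).hom = Ĝ ≫ D.hat.X.hom),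
        Nonempty ((Scheme.Modules.pullback
          (pullback.map A₁.X.hom D₁.hat.X.hom 𝒜.X.hom D.hat.X.hom G Ĝ (genOver S K P t).hom wG wĜ)).obj D.P ≅ D₁.P)) ∧
      lam₁.left ≫ Ĝ = G ≫ pol.lam.left) :
    ∃ (ρ : RingAction O (𝒜.baseChange (genOver S K P t).hom)) (H : A₁.X.left ⟶ (𝒜.baseChange (genOver S K P t).hom).X.left)
      (Ĥ : D₁.hat.X.left ⟶ (D.baseChange (genOver S K P t).hom).hat.X.left),
      IsIso H ∧ IsIso Ĥ ∧ H ≫ pullback.fst 𝒜.X.hom (genOver S K P t).hom = G ∧ Ĥ ≫ pullback.fst D.hat.X.hom (genOver S K P t).hom = Ĝ ∧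
      (φ₁.IsBaseChangeVia (lvl.baseChange (genOver S K P t).hom) (𝟙 _) H ∧
        D₁.hat.IsBaseChangeVia (D.baseChange (genOver S K P t).hom).hat (𝟙 _) Ĥ ∧
        (∃ (wG : A₁.X.hom ≫ 𝟙 _ = H ≫ (𝒜.baseChange (genOver S K P t).hom).X.hom)
            (wĜ : D₁.hat.X.hom ≫ 𝟙 _ = Ĥ ≫ (D.baseChange (genOver S K P t).hom).hat.X.hom),
          Nonempty ((Scheme.Modules.pullback
            (pullback.map A₁.X.hom D₁.hat.X.hom (𝒜.baseChange (genOver S K P t).hom).X.hom (D.baseChange (genOver S K P t).hom).hat.X.hom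
              H Ĥ (𝟙 _) wG wĜ)).obj (D.baseChange (genOver S K P t).hom).P ≅ D₁.P)) ∧
        lam₁.left ≫ Ĥ = H ≫ (pol.baseChange (genOver S K P t).hom).lam.left ∧ ∀ a : O, (ρ₁.i a).left ≫ H = H ≫ (ρ.i a).left) :=
  exists_ringAction_baseChange_tupleRel_id_of_tupleRel 𝒜 D pol lvl (genOver S K P t).hom ρ₁ h

end Stage

/-! ### §4 (EDITION 2) ALONG AN ISOMORPHISM OF BASES: the action descends to `𝒜 ×_S Y` and the source tuple is a six-clause pull-back of it
along `e : X′ ≅ Y` — the one-call shape of road Σ (`e :=` the model՚s generic isomorphism `X ≅ P ⊗ Spec K`, `g :=` the cone map) -/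

section IsoBase

variable {S Y X' : Scheme.{u}} (𝒜 : AbelianSchemeOver S) (D : 𝒜.DualPair) (pol : 𝒜.Polarization D) {g₀ n : ℕ} (lvl : 𝒜.LevelStructure g₀ n)
  (g : Y ⟶ S) (e : X' ⟶ Y) [IsIso e] {A₁ : AbelianSchemeOver X'} {D₁ : A₁.DualPair} (pol₁ : A₁.Polarization D₁)
  (φ₁ : A₁.LevelStructure g₀ n) {O : Type*} [CommRing O] (ρ₁ : RingAction O A₁) {G : A₁.X.left ⟶ 𝒜.X.left} {Ĝ : D₁.hat.X.left ⟶ D.hat.X.left}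

/-- **ACTION DESCENT ALONG AN ISOMORPHISM OF BASES** ([MumfordFogartyKirwan1994] Def. 7.2–7.3; [Kottwitz1992] §5).  Let `e : X′ → Y` be an
ISOMORPHISM of schemes, `g : Y → S`, `(𝒜, (Â, 𝒫), λ, φ)` an action-free tuple over `S`, and `(A₁, ρ₁, (Â₁, 𝒫₁), λ₁, φ₁)` a tuple WITH `𝒪`-action over
`X′` which is a pull-back of `𝒜`՚s tuple along `e ≫ g` (four clauses via `(G, Ĝ)`).  Then there are a ring action `ρ` on `𝒜 ×_S Y` and maps
`H : A₁ → 𝒜 ×_S Y`, `Ĥ : Â₁ → Â ×_S Y` satisfying ALL SIX clauses ALONG `e` from `(A₁, ρ₁, …)` to `(𝒜 ×_S Y, ρ, Â ×_S Y, 𝒫_Y, λ_Y, φ_Y)`.  ROAD Σ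
reads it with `e := 𝓜.genericIso⁻¹ : X ≅ P ⊗ Spec K`, `g := P ◁ leg` (★ `genOver`), `𝒜 :=` the pulled-back universal family over `P ⊗ D(t)`: the
output `ρ` is the input of ★ (s1-ι) `exists_stage_ringAction`, and the six-clause relation is the first link of the chain towards `PELSpreadAt.gen_iso`.
PROOF: move the source tuple to `Y` along `e⁻¹` (★ canonical clauses `tupleRel_baseChange_fst`), compose with the hypothesis (★ `tupleRel_trans`,
empty action index) and re-read along `g = e⁻¹ ≫ e ≫ g` (§1); descend the action (§2); come back from `A₁` to `(A₁ ×_{X′} Y) ×_Y X′` along `𝟙 X′`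
by uniqueness against reflexivity (★ `exists_tupleRel_id_of_tupleRel_of_tupleRel`, §1 `tupleRel_refl`), and compose `A₁ → (A₁)_{e⁻¹} ×_Y X′ → (A₁)_{e⁻¹}
→ 𝒜 ×_S Y` along `𝟙 ≫ e ≫ 𝟙 = e`. [cite: MumfordFogartyKirwan1994, Ch. 7 §2 Definition 7.2 (p. 129) and Definition 7.3 (p. 130)]
[cite: GortzWedhorn2020, Prop. 4.16 (p. 101) and Section (4.7) (pp. 107–108)] [cite: Kottwitz1992, §5 (p. 390)] -/
theorem exists_ringAction_baseChange_tupleRel_of_tupleRel_iso_comp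
    (h : φ₁.IsBaseChangeVia lvl (e ≫ g) G ∧ D₁.hat.IsBaseChangeVia D.hat (e ≫ g) Ĝ ∧
      (∃ (wG : A₁.X.hom ≫ e ≫ g = G ≫ 𝒜.X.hom) (wĜ : D₁.hat.X.hom ≫ e ≫ g = Ĝ ≫ D.hat.X.hom),
        Nonempty ((Scheme.Modules.pullback
          (pullback.map A₁.X.hom D₁.hat.X.hom 𝒜.X.hom D.hat.X.hom G Ĝ (e ≫ g) wG wĜ)).obj D.P ≅ D₁.P)) ∧
      pol₁.lam.left ≫ Ĝ = G ≫ pol.lam.left) :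
    ∃ (ρ : RingAction O (𝒜.baseChange g)) (H : A₁.X.left ⟶ (𝒜.baseChange g).X.left) (Ĥ : D₁.hat.X.left ⟶ (D.baseChange g).hat.X.left),
      φ₁.IsBaseChangeVia (lvl.baseChange g) e H ∧ D₁.hat.IsBaseChangeVia (D.baseChange g).hat e Ĥ ∧
        (∃ (wG : A₁.X.hom ≫ e = H ≫ (𝒜.baseChange g).X.hom) (wĜ : D₁.hat.X.hom ≫ e = Ĥ ≫ (D.baseChange g).hat.X.hom),
          Nonempty ((Scheme.Modules.pullback
            (pullback.map A₁.X.hom D₁.hat.X.hom (𝒜.baseChange g).X.hom (D.baseChange g).hat.X.hom H Ĥ e wG wĜ)).obj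
              (D.baseChange g).P ≅ D₁.P)) ∧
        pol₁.lam.left ≫ Ĥ = H ≫ (pol.baseChange g).lam.left ∧ ∀ a : O, (ρ₁.i a).left ≫ H = H ≫ (ρ.i a).left := by
  -- (1) the source tuple moved to `Y` along `e⁻¹`: `A₁' := A₁ ×_{X′} Y`, canonically a pull-back of `A₁` along `inv e` (with the actions)
  have c₁ := tupleRel_baseChange_fst A₁ ρ₁ D₁ pol₁ φ₁ (inv e)
  -- (2) compose with `h` (four clauses, empty action index) and re-read along `g = inv e ≫ e ≫ g`
  have r₁ := tupleRel_trans (O := PEmpty.{1}) (act'' := fun a => (PEmpty.elim a : (A₁.baseChange (inv e)).X ⟶ (A₁.baseChange (inv e)).X))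
    (act' := fun a => (PEmpty.elim a : A₁.X ⟶ A₁.X)) (act := fun a => (PEmpty.elim a : 𝒜.X ⟶ 𝒜.X))
    ⟨c₁.1, c₁.2.1, c₁.2.2.1, c₁.2.2.2.1, fun a => a.elim⟩ ⟨h.1, h.2.1, h.2.2.1, h.2.2.2, fun a => a.elim⟩
  have hg : inv e ≫ e ≫ g = g := by rw [IsIso.inv_hom_id_assoc]
  have r₂ := tupleRel_congr_base hg r₁
  -- (3) descend the action `ρ₁ ×_{X′} Y` to `𝒜 ×_S Y`
  obtain ⟨ρ, H₀, Ĥ₀, -, -, -, -, r₃⟩ :=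
    exists_ringAction_baseChange_tupleRel_id_of_tupleRel 𝒜 D pol lvl g (ρ₁.baseChange (inv e)) ⟨r₂.1, r₂.2.1, r₂.2.2.1, r₂.2.2.2.1⟩
  -- (4) `A₁ → (A₁ ×_{X′} Y) ×_Y X′` along `𝟙 X′`: both are pull-backs of `A₁` along `𝟙 X′ = e ≫ inv e`
  have c₂ := tupleRel_baseChange_fst (A₁.baseChange (inv e)) (ρ₁.baseChange (inv e)) (D₁.baseChange (inv e)) (pol₁.baseChange (inv e))
    (φ₁.baseChange (inv e)) e
  have hee : e ≫ inv e = 𝟙 X' := IsIso.hom_inv_id e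
  have c₂₁ := tupleRel_congr_base hee (tupleRel_trans c₂ c₁)
  obtain ⟨H₅, Ĥ₅, -, -, -, -, r₅⟩ := exists_tupleRel_id_of_tupleRel_of_tupleRel c₂₁ (tupleRel_refl A₁ D₁ pol₁.lam φ₁ ρ₁.i)
  -- (5) chain `A₁ →[𝟙] (A₁ ×_{X′} Y) ×_Y X′ →[e] A₁ ×_{X′} Y →[𝟙] 𝒜 ×_S Y`, re-read along `(𝟙 ≫ e) ≫ 𝟙 = e`
  have r₆ := tupleRel_trans (tupleRel_trans r₅ c₂) r₃
  have he : (𝟙 X' ≫ e) ≫ 𝟙 Y = e := by rw [Category.id_comp, Category.comp_id]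
  exact ⟨ρ, _, _, tupleRel_congr_base he r₆⟩

end IsoBase

end AbelianSchemeOver

end Literature.AlgebraicGeometry.AbelianSchemes

end
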